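import Mathlib.Algebra.CharP.Two
import Literature.AlgebraicGeometry.Resolution.SplittingLemmaHyperbolicPair
import Literature.AlgebraicGeometry.Resolution.FormalInverseFunction
import Literature.AlgebraicGeometry.Resolution.FormalInverseFunctionFintype
import HarnessLib

/-!
# Greuel–Pfister 2026, Lemma 3.4 (one hyperbolic pair, `l = 1`) in CHARACTERISTIC 2 — PROVED

Topic `Literature/AlgebraicGeometry/Resolution`; proof-lane companion (theorems only, no `def`, no `sorry`) of
`Literature/AlgebraicGeometry/Resolution/SplittingLemmaHyperbolicPair.lean` (the named fact
`GreuelPfister2026HyperbolicPairSplits`, typed over ALL fields and refuted as typed in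
`SplittingLemmaHyperbolicPairCounterexample.lean`) — here is the statement the print actually proves, with the same
binder shape plus the hypothesis `[CharP K 2]`, as the theorem `greuelPfister2026_hyperbolicPairSplits_charTwo`.

## Source

G.-M. Greuel, G. Pfister, *The splitting lemma in any characteristic*, J. Algebra 689 (2026) 610–628 =
arXiv:2507.17078 [GreuelPfister2026], §3 «Splitting Lemma in Characteristic 2» (arXiv p. 9), which opens «In this
section let `K` be a field of characteristic 2», and therein:

> **Lemma 3.4.** Let `K` be any field. The power series
> `f = ∑_{i odd, i=1}^{2l−1} (aᵢxᵢ² + bᵢxᵢxᵢ₊₁ + aᵢ₊₁xᵢ₊₁²) + ∑_{i=2l+1}^{n} dᵢxᵢ² + h(x₁,…,xₙ)` in `K[[x₁,…,xₙ]]`, with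
> `aᵢ, bᵢ, dᵢ ∈ K`, `bᵢ ≠ 0`, and `h ∈ 𝔪³`, is right equivalent (by a coordinate change mapping `xᵢ ↦ xᵢ` for
> `i ≥ 2l+1`) to `∑_{i odd} (aᵢ′xᵢ² + xᵢxᵢ₊₁ + aᵢ₊₁xᵢ₊₁²) + ∑_{i=2l+1}^{n} dᵢxᵢ² + h′(x_{2l+1},…,xₙ)`, with `aᵢ′ = aᵢ/bᵢ²`
> and `h′ ∈ ⟨x_{2l+1},…,xₙ⟩³`.
>
> *Proof.* Write `h = f₃ + x₁g₁ + … + x_{2l}g_{2l}` with `gᵢ ∈ 𝔪²` and `f₃ ∈ 𝔪³` not depending on `x₁,…,x_{2l}`. The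
> coordinate change `x₁ ↦ (1/b₁)(x₁ + g₂)`, `x₂ ↦ x₂ + (1/b₁)g₁`, …, `xᵢ ↦ xᵢ` for `i ≥ 2l+1` transforms `f` to
> `∑ ((aᵢ/bᵢ²)xᵢ² + xᵢxᵢ₊₁ + aᵢ₊₁xᵢ₊₁²) + ∑ dᵢxᵢ² + f₃ + f₄ + (x₁h₁ + … + x_{2l}h_{2l})` with suitable `hᵢ ∈ 𝔪³`,
> `f₄ ∈ ⟨x_{2l+1},…,xₙ⟩⁴`. Now make the coordinate change as above, but with `bᵢ = 1` […]. Continuing […] the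
> composition of the coordinate changes […] converges (in the `𝔪`-adic topology) to a formal coordinate change, with
> the sum in brackets being `0` in the limit.

(«any field» in §3 means an arbitrary field of characteristic 2, cf. Thm. 3.5 (1) «Let char(`K`) = 2. • Let `f ∈ 𝔪²
⊂ K[[x]]`, `K` any field»; the cancellation of `x₁g₁ + x₂g₂` against the cross terms of `(x₁ + g₂)(x₂ + g₁)` is the
characteristic-2 step.)  «Right equivalent» = related by a local automorphism of `K[[x]]` (p. 3), here a `K`-algebra
automorphism of `MvPowerSeries (Fin (n+2)) K` exactly as in the carpet.

## The proof formalised here (case `l = 1`: the pair `x = X 0`, `y = X 1`, the rest `zⱼ = X (j.addNat 2)`)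

Faithful to the print, with the iteration organised as a coefficientwise FIXED POINT rather than a limit of
automorphisms (the tree's formal inverse function theorem ★ `FormalCoordChange.exists_algEquiv_eq_subst` then turns
the limiting tangent-to-identity substitution into the automorphism in one step):

1. *Rescaling* (the `1/b₁` of the printed coordinate change): the diagonal automorphism `ρ : x ↦ b⁻¹x` (Mathlib
   `MvPowerSeries.rescaleAlgHom`, invertible since `b ≠ 0`) turns the quadratic part into
   `Q = (a/b²)x² + xy + cy² + ∑ dⱼzⱼ²` and `h` into `h₁ := ρ h ∈ 𝔪³`.
2. *Decomposition* `G = [G]₀ + x·[G]ₓ + y·[G]_y` with `[G]_y` free of `x` and `[G]₀ ∈ K[[z]]` (the print's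
   `h = f₃ + x₁g₁ + x₂g₂`): operators `pX, pY, pZ` given by their coefficient formulas (`decompose`).
3. *The correction map.* For `α, β ∈ 𝔪²` put `N(α, β) := αβ + (a/b²)β² + cα² + h₁(x + β, y + α, z)`. In
   characteristic 2, `Q(x + β, y + α, z) = Q + xα + yβ + βα + (a/b²)β² + cα²` (the squares produce NO mixed terms),
   so `f₁(x + β, y + α, z) = Q + (xα + yβ) + N(α, β)`; if `(α, β)` is a fixed point of
   `Θ(α, β) := ([N(α,β)]ₓ, [N(α,β)]_y)` then `xα + yβ + N = [N]₀ + 2(xα + yβ) = [N]₀ ∈ ⟨z⟩³` — the printed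
   cancellation.  Estimates: `Θ` preserves `𝔪² × 𝔪²` (`three_le_order_N`: `N ∈ 𝔪³`) and GAINS ONE DEGREE there
   (`agreeUpTo_N`: pairs agreeing up to degree `r` have `N`'s agreeing up to degree `r + 2`, by the two-degree gains
   `agreeUpTo_mul_gain_two` ∕ `agreeUpTo_subst_gain_two` for `𝔪²`-factors and `𝔪³`-series; `[·]ₓ`, `[·]_y` lose one).
4. *Successive approximation* `S₀ = (0,0)`, `S_{j+1} = Θ(S_j)`: `S_j ≡ S_{j+1}` up to degree `j + 1` (`iter_stable`),
   so the coefficientwise limit `(L₁, L₂)` exists (`agreeUpTo_lim`) and is a fixed point of `Θ` («converges in the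
   `𝔪`-adic topology … the sum in brackets being `0` in the limit»).
5. *Assembly*: `φ := ρ ≫ e` where `e` is the automorphism `x ↦ x + L₂`, `y ↦ y + L₁`, `z ↦ z`
   (★ `exists_algEquiv_eq_subst`, hypotheses `MonPlus` from `L₁, L₂ ∈ 𝔪²`); `h′ := [N(L₁, L₂)]₀`; the identity
   `φ(f) = (a/b²)x² + xy + cy² + ∑ dⱼzⱼ² + h′` is the computation of step 3 closed by `2 = 0` (`CharTwo.two_eq_zero`).

All auxiliaries are `private`; the tree's `AgreeUpTo` calculus (★ `FormalInverseFunction.lean`) supplies agreement up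
to a degree, its one-degree gains, and `agreeUpTo_iff_order`.  Not here: general `l` (iterate), the 2-jet normal form
(Arf, Thm. 3.1) and the uniqueness of the residual part (Thm. 3.5).

References: [GreuelPfister2026] Lemma 3.4 and its proof, §3 first sentence, Thm. 3.5 (1) (arXiv:2507.17078 p. 9);
G.-M. Greuel, G. Pfister, *A Singular introduction to commutative algebra* (2002), Thm. 6.2.18 (formal inverse function
theorem) [GreuelPfister2002] — through the tree's ★ `FormalInverseFunctionFintype.lean`.
-/

noncomputable section

open MvPowerSeries

namespace Literature.AlgebraicGeometry.Resolution

namespace SplittingLemmaHyperbolicPairCharTwo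

open Literature.AlgebraicGeometry.Resolution.FormalCoordChange

universe u

variable {K : Type*} [Field K]

/-! ## §0 Generic order bookkeeping -/

section Generic

variable {σ : Type*}

/-- Coefficients of `X s · G`. [folklore] -/
private theorem coeff_X_mul' [DecidableEq σ] (s : σ) (G : MvPowerSeries σ K) (m : σ →₀ ℕ) :
    coeff m (X s * G) = if m s = 0 then 0 else coeff (m - Finsupp.single s 1) G := by
  rw [X_def, coeff_monomial_mul, one_mul]
  by_cases h : m s = 0
  · rw [if_neg, if_pos h]
    rw [Finsupp.single_le_iff]; omega
  · rw [if_pos, if_neg h]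
    rw [Finsupp.single_le_iff]; omega

/-- `k ≤ order f` and `k ≤ order g` give `k ≤ order (f + g)`. [folklore] -/
private theorem le_order_add' {k : ℕ∞} {f g : MvPowerSeries σ K} (hf : k ≤ f.order) (hg : k ≤ g.order) :
    k ≤ (f + g).order :=
  le_trans (le_min hf hg) min_order_le_add

/-- `k ≤ order g` gives `k ≤ order (f * g)`. [folklore] -/
private theorem le_order_mul_left' {k : ℕ∞} (f : MvPowerSeries σ K) {g : MvPowerSeries σ K}
    (hg : k ≤ g.order) : k ≤ (f * g).order :=
  le_trans (le_trans hg le_add_self) le_order_mul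

/-- The product `∏ᵢ bᵢ^{dᵢ}` of series without constant term has order `≥ |d|`. [folklore] -/
private theorem degree_le_order_finsuppProd {ι : Type*} (b : ι → MvPowerSeries σ K)
    (hb : ∀ i, constantCoeff (b i) = 0) (d : ι →₀ ℕ) :
    (d.degree : ℕ∞) ≤ (d.prod fun i m => b i ^ m).order := by
  rw [Finsupp.prod, Finsupp.degree_apply, Nat.cast_sum]
  refine le_trans (Finset.sum_le_sum fun i _ => ?_) (le_order_prod _ _)
  calc ((d i : ℕ) : ℕ∞) = d i • (1 : ℕ∞) := by simp
    _ ≤ d i • (b i).order := nsmul_le_nsmul_right (one_le_order_iff_constCoeff_eq_zero.mpr (hb i)) _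
    _ ≤ (b i ^ d i).order := le_order_pow _

/-- A substitution by series without constant terms does not lower the order. [folklore] -/
private theorem le_order_subst' {τ : Type*} [Finite τ] (a : τ → MvPowerSeries σ K)
    (ha : ∀ i, constantCoeff (a i) = 0) (f : MvPowerSeries τ K) : f.order ≤ (subst a f).order := by
  have h1 : (1 : ℕ∞) ≤ ⨅ i, (a i).order :=
    le_iInf fun i => one_le_order_iff_constCoeff_eq_zero.mpr (ha i)
  calc f.order = 1 * f.order := (one_mul _).symm
    _ ≤ (⨅ i, (a i).order) * f.order := mul_le_mul' h1 le_rfl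
    _ ≤ _ := le_order_subst (hasSubst_of_constantCoeff_zero ha) f

end Generic

/-! ## §1 Agreement up to a degree: the two-degree gains (`𝔪²`-perturbations, `𝔪³`-series) -/

section Gains

variable {N : ℕ}

/-- `2 ≤ order` implies zero constant coefficient. [folklore] -/
private theorem constantCoeff_eq_zero_of_two_le {u : MvPowerSeries (Fin N) K} (hu : 2 ≤ u.order) :
    constantCoeff u = 0 :=
  ((two_le_order_iff u).mp hu).1

/-- TWO-DEGREE GAIN for products of `𝔪²`-series: if `u ≡ u'`, `v ≡ v'` up to degree `r` and `u, v' ∈ 𝔪²` then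
`uv ≡ u'v'` up to degree `r + 2`. [folklore] -/
private theorem agreeUpTo_mul_gain_two {r : ℕ} {u v u' v' : MvPowerSeries (Fin N) K} (h : AgreeUpTo r u u')
    (h' : AgreeUpTo r v v') (hu : 2 ≤ u.order) (hv' : 2 ≤ v'.order) :
    AgreeUpTo (r + 2) (u * v) (u' * v') := by
  rw [agreeUpTo_iff_order] at h h' ⊢
  have e1 : u * v - u' * v' = u * (v - v') + (u - u') * v' := by ring
  rw [e1]
  refine le_order_add' ?_ ?_
  · refine le_trans ?_ le_order_mul
    calc (((r + 2 + 1 : ℕ)) : ℕ∞) = 2 + ((r + 1 : ℕ) : ℕ∞) := by push_cast; ring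
      _ ≤ u.order + (v - v').order := add_le_add hu h'
  · refine le_trans ?_ le_order_mul
    calc (((r + 2 + 1 : ℕ)) : ℕ∞) = ((r + 1 : ℕ) : ℕ∞) + 2 := by push_cast; ring
      _ ≤ (u - u').order + v'.order := add_le_add h hv'

/-- TWO-DEGREE GAIN for monomials of degree `≥ 3` in families without constant terms. [folklore] -/
private theorem agreeUpTo_finsuppProd_gain_two {r : ℕ} {a a' : Fin N → MvPowerSeries (Fin N) K}
    (h : ∀ i, AgreeUpTo r (a i) (a' i)) (ha : ∀ i, constantCoeff (a i) = 0)
    (ha' : ∀ i, constantCoeff (a' i) = 0) (d : Fin N →₀ ℕ) (hd : 3 ≤ d.degree) :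
    AgreeUpTo (r + 2) (d.prod fun i m => a i ^ m) (d.prod fun i m => a' i ^ m) := by
  classical
  have hd0 : d ≠ 0 := by intro h0; rw [h0] at hd; simp at hd
  obtain ⟨i₀, hi₀⟩ : ∃ i, d i ≠ 0 := by
    by_contra hcon; push Not at hcon; exact hd0 (Finsupp.ext hcon)
  set d' := d - Finsupp.single i₀ 1 with hd'
  have hsplit : d = Finsupp.single i₀ 1 + d' := by
    ext j
    by_cases hj : j = i₀
    · subst hj; simp [hd']; omega
    · simp [hd', Ne.symm hj]
  have hdeg' : 2 ≤ d'.degree := by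
    have := congrArg Finsupp.degree hsplit
    rw [map_add, Finsupp.degree_single] at this
    omega
  have key : ∀ (b : Fin N → MvPowerSeries (Fin N) K),
      (d.prod fun i m => b i ^ m) = b i₀ * d'.prod fun i m => b i ^ m := by
    intro b
    rw [hsplit, Finsupp.prod_add_index' (h := fun i m => b i ^ m) (fun _ => pow_zero _)
      (fun _ _ _ => pow_add _ _ _), Finsupp.prod_single_index (h := fun i m => b i ^ m) (pow_zero _),
      pow_one]
  rw [key a, key a']
  -- the two pieces
  have hP : AgreeUpTo (r + 1) (d'.prod fun i m => a i ^ m) (d'.prod fun i m => a' i ^ m) :=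
    AgreeUpTo.finsuppProd_gain h ha ha' d' hdeg'
  have hP' : (2 : ℕ∞) ≤ (d'.prod fun i m => a' i ^ m).order :=
    le_trans (by exact_mod_cast hdeg') (degree_le_order_finsuppProd a' ha' d')
  have hai : (1 : ℕ∞) ≤ (a i₀).order := one_le_order_iff_constCoeff_eq_zero.mpr (ha i₀)
  have hdi := h i₀
  rw [agreeUpTo_iff_order] at hP hdi ⊢
  have e1 : a i₀ * (d'.prod fun i m => a i ^ m) - a' i₀ * (d'.prod fun i m => a' i ^ m) =
      a i₀ * ((d'.prod fun i m => a i ^ m) - d'.prod fun i m => a' i ^ m) +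
        (a i₀ - a' i₀) * d'.prod fun i m => a' i ^ m := by ring
  rw [e1]
  refine le_order_add' ?_ ?_
  · refine le_trans ?_ le_order_mul
    calc (((r + 2 + 1 : ℕ)) : ℕ∞) = 1 + ((r + 1 + 1 : ℕ) : ℕ∞) := by push_cast; ring
      _ ≤ (a i₀).order + _ := add_le_add hai hP
  · refine le_trans ?_ le_order_mul
    calc (((r + 2 + 1 : ℕ)) : ℕ∞) = ((r + 1 : ℕ) : ℕ∞) + 2 := by push_cast; ring
      _ ≤ (a i₀ - a' i₀).order + _ := add_le_add hdi hP'

/-- TWO-DEGREE GAIN under substitution into a series of order `≥ 3`. [folklore] -/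
private theorem agreeUpTo_subst_gain_two {r : ℕ} {a a' : Fin N → MvPowerSeries (Fin N) K}
    (h : ∀ i, AgreeUpTo r (a i) (a' i)) (ha : ∀ i, constantCoeff (a i) = 0)
    (ha' : ∀ i, constantCoeff (a' i) = 0) {H : MvPowerSeries (Fin N) K} (hH : 3 ≤ H.order) :
    AgreeUpTo (r + 2) (subst a H) (subst a' H) := by
  intro e he
  rw [coeff_subst (hasSubst_of_constantCoeff_zero ha), coeff_subst (hasSubst_of_constantCoeff_zero ha')]
  refine finsum_congr fun d => ?_
  by_cases hd : 3 ≤ d.degree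
  · congr 1
    exact (agreeUpTo_finsuppProd_gain_two h ha ha' d hd) e he
  · have : coeff d H = 0 :=
      coeff_of_lt_order (lt_of_lt_of_le (by exact_mod_cast (by omega : d.degree < 3)) hH)
    simp [this]

/-- Series of order `≥ 2` agree up to degree `1` (all those coefficients vanish). [folklore] -/
private theorem agreeUpTo_one_of_two_le {u v : MvPowerSeries (Fin N) K} (hu : 2 ≤ u.order) (hv : 2 ≤ v.order) :
    AgreeUpTo 1 u v := by
  intro e he
  have he' : ((Finsupp.degree e : ℕ) : ℕ∞) < 2 := by exact_mod_cast Nat.lt_succ_of_le he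
  rw [coeff_of_lt_order (lt_of_lt_of_le he' hu), coeff_of_lt_order (lt_of_lt_of_le he' hv)]

/-- Coefficientwise limits: agreement at every degree is equality. [folklore] -/
private theorem eq_of_forall_agreeUpTo {u v : MvPowerSeries (Fin N) K} (h : ∀ r, AgreeUpTo r u v) : u = v := by
  ext e
  exact h e.degree e le_rfl

end Gains

/-! ## §2 The decomposition `G = G₀(z) + x·[G]ₓ + y·[G]_y` on `K⟦x, y, z₁, …, z_n⟧` (`x = X 0`, `y = X 1`) -/

section Parts

variable {n : ℕ}

/-- Rescaling a variable: `rescale u (X i) = u i · X i`. [folklore] -/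
private theorem rescale_X' {σ : Type*} (u : σ → K) (i : σ) :
    rescale u (X i : MvPowerSeries σ K) = C (u i) * X i := by
  classical
  ext m
  rw [coeff_rescale, coeff_C_mul, coeff_X]
  split_ifs with hm
  · subst hm; simp
  · simp

/-- `(m - e₁) 0 = m 0` on `Fin (n + 2)`. [folklore] -/
private theorem tsub_single_one_apply_zero (m : Fin (n + 2) →₀ ℕ) :
    (m - Finsupp.single (1 : Fin (n + 2)) 1 : Fin (n + 2) →₀ ℕ) 0 = m 0 := by
  rw [Finsupp.tsub_apply, Finsupp.single_apply, if_neg (by simp), tsub_zero]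

/-- `m - eᵢ + eᵢ = m` when `m i ≠ 0`. [folklore] -/
private theorem tsub_single_add_single {σ : Type*} (m : σ →₀ ℕ) (i : σ) (hi : m i ≠ 0) :
    m - Finsupp.single i 1 + Finsupp.single i 1 = m :=
  tsub_add_cancel_of_le (Finsupp.single_le_iff.mpr (Nat.one_le_iff_ne_zero.mpr hi))

/-- The decomposition `G = [G]₀ + X 0 · [G]ₓ + X 1 · [G]_y` for ANY operators with the displayed coefficient formulas
(`[G]_y` is `x`-free, `[G]₀` is `x`- and `y`-free). [folklore] -/
private theorem decompose (pX pY pZ : MvPowerSeries (Fin (n + 2)) K → MvPowerSeries (Fin (n + 2)) K)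
    (hX : ∀ G m, coeff m (pX G) = coeff (m + Finsupp.single 0 1) G)
    (hY : ∀ G m, coeff m (pY G) = if m 0 = 0 then coeff (m + Finsupp.single 1 1) G else 0)
    (hZ : ∀ G m, coeff m (pZ G) = if m 0 = 0 ∧ m 1 = 0 then coeff m G else 0)
    (G : MvPowerSeries (Fin (n + 2)) K) : G = pZ G + X 0 * pX G + X 1 * pY G := by
  classical
  ext m
  rw [map_add, map_add, coeff_X_mul', coeff_X_mul', hZ]
  by_cases h0 : m 0 = 0
  · by_cases h1 : m 1 = 0
    · rw [if_pos ⟨h0, h1⟩, if_pos h0, if_pos h1, add_zero, add_zero]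
    · rw [if_neg (fun h => h1 h.2), if_pos h0, if_neg h1, hY, if_pos (by rw [tsub_single_one_apply_zero, h0]),
        tsub_single_add_single m 1 h1, zero_add, zero_add]
  · rw [if_neg (fun h => h0 h.1), if_neg h0, hX, tsub_single_add_single m 0 h0, zero_add]
    by_cases h1 : m 1 = 0
    · rw [if_pos h1, add_zero]
    · rw [if_neg h1, hY, if_neg (by rw [tsub_single_one_apply_zero]; exact h0), add_zero]

/-- `[·]ₓ` loses at most one degree of agreement. [folklore] -/
private theorem agreeUpTo_pX (pX : MvPowerSeries (Fin (n + 2)) K → MvPowerSeries (Fin (n + 2)) K)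
    (hX : ∀ G m, coeff m (pX G) = coeff (m + Finsupp.single 0 1) G) {r : ℕ} {G G' : MvPowerSeries (Fin (n + 2)) K}
    (h : AgreeUpTo (r + 1) G G') : AgreeUpTo r (pX G) (pX G') := by
  intro e he
  rw [hX, hX]
  exact h _ (by rw [map_add, Finsupp.degree_single]; omega)

/-- `[·]_y` loses at most one degree of agreement. [folklore] -/
private theorem agreeUpTo_pY (pY : MvPowerSeries (Fin (n + 2)) K → MvPowerSeries (Fin (n + 2)) K)
    (hY : ∀ G m, coeff m (pY G) = if m 0 = 0 then coeff (m + Finsupp.single 1 1) G else 0) {r : ℕ}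
    {G G' : MvPowerSeries (Fin (n + 2)) K} (h : AgreeUpTo (r + 1) G G') : AgreeUpTo r (pY G) (pY G') := by
  intro e he
  rw [hY, hY]
  split_ifs
  · exact h _ (by rw [map_add, Finsupp.degree_single]; omega)
  · rfl

/-- `[·]ₓ` lowers the order by at most one. [folklore] -/
private theorem le_order_pX (pX : MvPowerSeries (Fin (n + 2)) K → MvPowerSeries (Fin (n + 2)) K)
    (hX : ∀ G m, coeff m (pX G) = coeff (m + Finsupp.single 0 1) G) {k : ℕ} {G : MvPowerSeries (Fin (n + 2)) K}
    (h : ((k + 1 : ℕ) : ℕ∞) ≤ G.order) : (k : ℕ∞) ≤ (pX G).order := by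
  refine nat_le_order fun e he => ?_
  rw [hX]
  exact coeff_of_lt_order (lt_of_lt_of_le (by rw [map_add, Finsupp.degree_single]; exact_mod_cast (by omega)) h)

/-- `[·]_y` lowers the order by at most one. [folklore] -/
private theorem le_order_pY (pY : MvPowerSeries (Fin (n + 2)) K → MvPowerSeries (Fin (n + 2)) K)
    (hY : ∀ G m, coeff m (pY G) = if m 0 = 0 then coeff (m + Finsupp.single 1 1) G else 0) {k : ℕ}
    {G : MvPowerSeries (Fin (n + 2)) K} (h : ((k + 1 : ℕ) : ℕ∞) ≤ G.order) : (k : ℕ∞) ≤ (pY G).order := by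
  refine nat_le_order fun e he => ?_
  rw [hY]
  split_ifs
  · exact coeff_of_lt_order (lt_of_lt_of_le (by rw [map_add, Finsupp.degree_single]; exact_mod_cast (by omega)) h)
  · rfl

end Parts

/-! ## §3 The correction map `N(α, β) = αβ + a′β² + cα² + h₁(x + β, y + α, z)` and its two estimates -/

section Correction

variable {n : ℕ}

/-- The perturbation `δ = (β, α, 0, …, 0)` of the coordinates has order `≥ 2` if `α, β` do. [folklore] -/
private theorem two_le_order_delta {α β : MvPowerSeries (Fin (n + 2)) K} (hα : 2 ≤ α.order) (hβ : 2 ≤ β.order)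
    (i : Fin (n + 2)) : 2 ≤ (if i = 0 then β else if i = 1 then α else (0 : MvPowerSeries (Fin (n + 2)) K)).order := by
  split_ifs
  · exact hβ
  · exact hα
  · simp

/-- The coordinate family `(x + β, y + α, z)` has no constant terms. [folklore] -/
private theorem constantCoeff_shift (Sf : MvPowerSeries (Fin (n + 2)) K → MvPowerSeries (Fin (n + 2)) K →
      Fin (n + 2) → MvPowerSeries (Fin (n + 2)) K)
    (hSf : ∀ α β i, Sf α β i = X i + (if i = 0 then β else if i = 1 then α else 0))
    {α β : MvPowerSeries (Fin (n + 2)) K} (hα : 2 ≤ α.order) (hβ : 2 ≤ β.order) (i : Fin (n + 2)) :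
    constantCoeff (Sf α β i) = 0 := by
  rw [hSf, map_add, constantCoeff_X, zero_add]
  exact constantCoeff_eq_zero_of_two_le (two_le_order_delta hα hβ i)

/-- The coordinate family `(x + β, y + α, z)` is tangent to the identity. [folklore] -/
private theorem monPlus_shift (Sf : MvPowerSeries (Fin (n + 2)) K → MvPowerSeries (Fin (n + 2)) K →
      Fin (n + 2) → MvPowerSeries (Fin (n + 2)) K)
    (hSf : ∀ α β i, Sf α β i = X i + (if i = 0 then β else if i = 1 then α else 0))
    {α β : MvPowerSeries (Fin (n + 2)) K} (hα : 2 ≤ α.order) (hβ : 2 ≤ β.order) (i : Fin (n + 2)) :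
    MonPlus (Sf α β i) (Finsupp.single i 1) := by
  rw [hSf]
  exact monPlus_X_add i (two_le_order_delta hα hβ i)

/-- Agreement of the coordinate families. [folklore] -/
private theorem agreeUpTo_shift (Sf : MvPowerSeries (Fin (n + 2)) K → MvPowerSeries (Fin (n + 2)) K →
      Fin (n + 2) → MvPowerSeries (Fin (n + 2)) K)
    (hSf : ∀ α β i, Sf α β i = X i + (if i = 0 then β else if i = 1 then α else 0))
    {r : ℕ} {α β α' β' : MvPowerSeries (Fin (n + 2)) K} (hα : AgreeUpTo r α α') (hβ : AgreeUpTo r β β')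
    (i : Fin (n + 2)) : AgreeUpTo r (Sf α β i) (Sf α' β' i) := by
  rw [hSf, hSf]
  refine (AgreeUpTo.refl r _).add ?_
  split_ifs
  · exact hβ
  · exact hα
  · exact AgreeUpTo.refl r _

/-- ORDER ESTIMATE: for `α, β ∈ 𝔪²` and `h₁ ∈ 𝔪³`, `N(α, β) ∈ 𝔪³`. [folklore] -/
private theorem three_le_order_N (Sf : MvPowerSeries (Fin (n + 2)) K → MvPowerSeries (Fin (n + 2)) K →
      Fin (n + 2) → MvPowerSeries (Fin (n + 2)) K)
    (hSf : ∀ α β i, Sf α β i = X i + (if i = 0 then β else if i = 1 then α else 0))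
    (a' c : K) (h₁ : MvPowerSeries (Fin (n + 2)) K) (hh₁ : 3 ≤ h₁.order)
    (Nf : MvPowerSeries (Fin (n + 2)) K → MvPowerSeries (Fin (n + 2)) K → MvPowerSeries (Fin (n + 2)) K)
    (hNf : ∀ α β, Nf α β = α * β + C a' * β ^ 2 + C c * α ^ 2 + subst (Sf α β) h₁)
    {α β : MvPowerSeries (Fin (n + 2)) K} (hα : 2 ≤ α.order) (hβ : 2 ≤ β.order) : 3 ≤ (Nf α β).order := by
  have h4 : (3 : ℕ∞) ≤ 2 + 2 := by norm_num
  rw [hNf]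
  refine le_order_add' (le_order_add' (le_order_add' ?_ ?_) ?_) ?_
  · exact le_trans (le_trans h4 (add_le_add hα hβ)) le_order_mul
  · refine le_order_mul_left' _ ?_
    rw [pow_two]; exact le_trans (le_trans h4 (add_le_add hβ hβ)) le_order_mul
  · refine le_order_mul_left' _ ?_
    rw [pow_two]; exact le_trans (le_trans h4 (add_le_add hα hα)) le_order_mul
  · exact le_trans hh₁ (le_order_subst' _ (constantCoeff_shift Sf hSf hα hβ) h₁)

/-- CONTRACTION ESTIMATE: `𝔪²`-pairs agreeing up to degree `r` have corrections agreeing up to degree `r + 2`.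
[folklore] -/
private theorem agreeUpTo_N (Sf : MvPowerSeries (Fin (n + 2)) K → MvPowerSeries (Fin (n + 2)) K →
      Fin (n + 2) → MvPowerSeries (Fin (n + 2)) K)
    (hSf : ∀ α β i, Sf α β i = X i + (if i = 0 then β else if i = 1 then α else 0))
    (a' c : K) (h₁ : MvPowerSeries (Fin (n + 2)) K) (hh₁ : 3 ≤ h₁.order)
    (Nf : MvPowerSeries (Fin (n + 2)) K → MvPowerSeries (Fin (n + 2)) K → MvPowerSeries (Fin (n + 2)) K)
    (hNf : ∀ α β, Nf α β = α * β + C a' * β ^ 2 + C c * α ^ 2 + subst (Sf α β) h₁)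
    {r : ℕ} {α β α' β' : MvPowerSeries (Fin (n + 2)) K} (hα : 2 ≤ α.order) (hβ : 2 ≤ β.order)
    (hα' : 2 ≤ α'.order) (hβ' : 2 ≤ β'.order) (hαα : AgreeUpTo r α α') (hββ : AgreeUpTo r β β') :
    AgreeUpTo (r + 2) (Nf α β) (Nf α' β') := by
  rw [hNf, hNf]
  refine AgreeUpTo.add (AgreeUpTo.add (AgreeUpTo.add ?_ ?_) ?_) ?_
  · exact agreeUpTo_mul_gain_two hαα hββ hα hβ'
  · rw [pow_two, pow_two]
    exact (AgreeUpTo.refl _ _).mul (agreeUpTo_mul_gain_two hββ hββ hβ hβ')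
  · rw [pow_two, pow_two]
    exact (AgreeUpTo.refl _ _).mul (agreeUpTo_mul_gain_two hαα hαα hα hα')
  · exact agreeUpTo_subst_gain_two (agreeUpTo_shift Sf hSf hαα hββ) (constantCoeff_shift Sf hSf hα hβ)
      (constantCoeff_shift Sf hSf hα' hβ') hh₁

end Correction

/-! ## §4 The successive approximation and its coefficientwise limit -/

section Iteration

variable {N : ℕ}

/-- Orders along the iteration `S₀ = (0, 0)`, `S_{j+1} = Θ(S_j)` of an `𝔪²`-preserving map. [folklore] -/
private theorem iter_two_le_order
    (Θ : MvPowerSeries (Fin N) K × MvPowerSeries (Fin N) K → MvPowerSeries (Fin N) K × MvPowerSeries (Fin N) K)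
    (hΘord : ∀ p : MvPowerSeries (Fin N) K × MvPowerSeries (Fin N) K,
      2 ≤ p.1.order → 2 ≤ p.2.order → 2 ≤ (Θ p).1.order ∧ 2 ≤ (Θ p).2.order)
    (S : ℕ → MvPowerSeries (Fin N) K × MvPowerSeries (Fin N) K) (hS0 : S 0 = (0, 0)) (hS : ∀ j, S (j + 1) = Θ (S j)) :
    ∀ j, 2 ≤ (S j).1.order ∧ 2 ≤ (S j).2.order
  | 0 => by rw [hS0]; simp
  | j + 1 => by
    rw [hS]
    exact hΘord _ (iter_two_le_order Θ hΘord S hS0 hS j).1 (iter_two_le_order Θ hΘord S hS0 hS j).2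

/-- STABILITY of the iteration of a map that is `𝔪²`-preserving and gains one degree: `S_j ≡ S_{j+1}` up to degree
`j + 1`. [folklore] -/
private theorem iter_stable
    (Θ : MvPowerSeries (Fin N) K × MvPowerSeries (Fin N) K → MvPowerSeries (Fin N) K × MvPowerSeries (Fin N) K)
    (hΘord : ∀ p : MvPowerSeries (Fin N) K × MvPowerSeries (Fin N) K,
      2 ≤ p.1.order → 2 ≤ p.2.order → 2 ≤ (Θ p).1.order ∧ 2 ≤ (Θ p).2.order)
    (hΘgain : ∀ (r : ℕ) (p q : MvPowerSeries (Fin N) K × MvPowerSeries (Fin N) K),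
      2 ≤ p.1.order → 2 ≤ p.2.order → 2 ≤ q.1.order → 2 ≤ q.2.order →
      AgreeUpTo r p.1 q.1 → AgreeUpTo r p.2 q.2 → AgreeUpTo (r + 1) (Θ p).1 (Θ q).1 ∧ AgreeUpTo (r + 1) (Θ p).2 (Θ q).2)
    (S : ℕ → MvPowerSeries (Fin N) K × MvPowerSeries (Fin N) K) (hS0 : S 0 = (0, 0)) (hS : ∀ j, S (j + 1) = Θ (S j)) :
    ∀ j, AgreeUpTo (j + 1) (S j).1 (S (j + 1)).1 ∧ AgreeUpTo (j + 1) (S j).2 (S (j + 1)).2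
  | 0 => by
    have h0 := iter_two_le_order Θ hΘord S hS0 hS 0
    have h1 := iter_two_le_order Θ hΘord S hS0 hS 1
    exact ⟨agreeUpTo_one_of_two_le h0.1 h1.1, agreeUpTo_one_of_two_le h0.2 h1.2⟩
  | j + 1 => by
    have hj := iter_two_le_order Θ hΘord S hS0 hS j
    have hj1 := iter_two_le_order Θ hΘord S hS0 hS (j + 1)
    have ih := iter_stable Θ hΘord hΘgain S hS0 hS j
    have key := hΘgain (j + 1) (S j) (S (j + 1)) hj.1 hj.2 hj1.1 hj1.2 ih.1 ih.2
    rwa [← hS j, ← hS (j + 1)] at key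

/-- Stability propagates: `T_i ≡ T_j` up to degree `i` for `i ≤ j`. [folklore] -/
private theorem stable_le {T : ℕ → MvPowerSeries (Fin N) K} (hT : ∀ j, AgreeUpTo (j + 1) (T j) (T (j + 1)))
    {i j : ℕ} (hij : i ≤ j) : AgreeUpTo i (T i) (T j) := by
  induction hij with
  | refl => exact AgreeUpTo.refl _ _
  | step hle ih => exact ih.trans ((hT _).mono (Nat.le_succ_of_le hle))

/-- The coefficientwise limit `L` (coefficient `e` taken from `T_{|e|}`) agrees with `T_j` up to degree `j`. [folklore] -/
private theorem agreeUpTo_lim {T : ℕ → MvPowerSeries (Fin N) K} (hT : ∀ j, AgreeUpTo (j + 1) (T j) (T (j + 1)))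
    (L : MvPowerSeries (Fin N) K) (hL : ∀ e, coeff e L = coeff e (T e.degree)) (j : ℕ) : AgreeUpTo j (T j) L := by
  intro e he
  rw [hL]
  exact ((stable_le hT he) e le_rfl).symm

end Iteration

end SplittingLemmaHyperbolicPairCharTwo

open SplittingLemmaHyperbolicPairCharTwo Literature.AlgebraicGeometry.Resolution.FormalCoordChange in
/-- **Greuel–Pfister 2026, Lemma 3.4 (case `l = 1`, one hyperbolic pair) in CHARACTERISTIC 2 — PROVED.**
«Let `K` be any field [of characteristic 2, the standing hypothesis of §3]. The power series
`f = a₁x₁² + b₁x₁x₂ + a₂x₂² + ∑_{i ≥ 3} dᵢxᵢ² + h(x₁,…,xₙ)` in `K[[x₁,…,xₙ]]`, with `b₁ ≠ 0` and `h ∈ 𝔪³`, is right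
equivalent (by a coordinate change mapping `xᵢ ↦ xᵢ` for `i ≥ 3`) to `a₁′x₁² + x₁x₂ + a₂x₂² + ∑_{i ≥ 3} dᵢxᵢ² + h′(x₃,…,xₙ)`
with `a₁′ = a₁/b₁²` and `h′ ∈ ⟨x₃,…,xₙ⟩³`.»  Same binder shape as the named fact `GreuelPfister2026HyperbolicPairSplits`
(variables `X 0, X 1` = the pair, `X (j.addNat 2)` = the rest) plus the hypothesis `[CharP K 2]` under which the print
proves it; the proof is the printed successive approximation (coordinate change `x ↦ x/b`, then `x ↦ x + g₂`, `y ↦ y + g₁`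
iterated, converging `𝔪`-adically), organised as a coefficientwise fixed point.
[cite: GreuelPfister2026, Lemma 3.4 (arXiv:2507.17078 p. 9) with §3 first sentence «let K be a field of characteristic 2»] -/
theorem greuelPfister2026_hyperbolicPairSplits_charTwo (K : Type*) [Field K] [CharP K 2] (n : ℕ) (a b c : K)
    (d : Fin n → K) (h : MvPowerSeries (Fin (n + 2)) K) (hb : b ≠ 0)
    (hh : ∀ m : Fin (n + 2) →₀ ℕ, coeff m h ≠ 0 → 3 ≤ m.sum (fun _ e => e)) :
    ∃ (φ : MvPowerSeries (Fin (n + 2)) K ≃ₐ[K] MvPowerSeries (Fin (n + 2)) K)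
      (h' : MvPowerSeries (Fin (n + 2)) K),
      (∀ j : Fin n, φ (X (j.addNat 2) : MvPowerSeries (Fin (n + 2)) K) = X (j.addNat 2)) ∧
      (∀ m : Fin (n + 2) →₀ ℕ, coeff m h' ≠ 0 → 3 ≤ m.sum (fun _ e => e) ∧ m 0 = 0 ∧ m 1 = 0) ∧
      φ ((C a * X (0 : Fin (n + 2)) ^ 2 + C b * X (0 : Fin (n + 2)) * X (1 : Fin (n + 2)) +
          C c * X (1 : Fin (n + 2)) ^ 2 +
          (∑ j : Fin n, C (d j) * (X (j.addNat 2) : MvPowerSeries (Fin (n + 2)) K) ^ 2) + h :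
            MvPowerSeries (Fin (n + 2)) K)) =
        (C (a / b ^ 2) * X (0 : Fin (n + 2)) ^ 2 + X (0 : Fin (n + 2)) * X (1 : Fin (n + 2)) +
          C c * X (1 : Fin (n + 2)) ^ 2 +
          (∑ j : Fin n, C (d j) * (X (j.addNat 2) : MvPowerSeries (Fin (n + 2)) K) ^ 2) + h' :
            MvPowerSeries (Fin (n + 2)) K) := by
  classical
  -- degree bookkeeping: `h ∈ 𝔪³`
  have hdeg : ∀ m : Fin (n + 2) →₀ ℕ, m.sum (fun _ e => e) = m.degree := fun m => rfl
  have h3 : (3 : ℕ∞) ≤ h.order := by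
    refine nat_le_order fun m hm => ?_
    by_contra hne
    have h3m := hh m hne
    rw [hdeg] at h3m
    have hm' : m.degree < 3 := by exact_mod_cast hm
    omega
  -- §a the rescaling `x ↦ b⁻¹ x` as a `K`-algebra automorphism `ρ`
  obtain ⟨u, hu⟩ : ∃ u : Fin (n + 2) → K, ∀ i, u i = if i = 0 then b⁻¹ else 1 := ⟨_, fun _ => rfl⟩
  obtain ⟨u', hu'⟩ : ∃ u' : Fin (n + 2) → K, ∀ i, u' i = if i = 0 then b else 1 := ⟨_, fun _ => rfl⟩
  have huu' : u' * u = 1 := by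
    funext i; rw [Pi.mul_apply, hu, hu', Pi.one_apply]; split_ifs <;> simp [hb]
  have hu'u : u * u' = 1 := by
    funext i; rw [Pi.mul_apply, hu, hu', Pi.one_apply]; split_ifs <;> simp [hb]
  obtain ⟨ρ, hρ⟩ : ∃ ρ : MvPowerSeries (Fin (n + 2)) K ≃ₐ[K] MvPowerSeries (Fin (n + 2)) K,
      ∀ F, ρ F = rescale u F :=
    ⟨AlgEquiv.ofAlgHom (rescaleAlgHom u) (rescaleAlgHom u')
        (by rw [← rescaleAlgHom_mul, huu', rescaleAlgHom_one])
        (by rw [← rescaleAlgHom_mul, hu'u, rescaleAlgHom_one]),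
      fun F => by rw [AlgEquiv.ofAlgHom_apply, rescaleAlgHom_apply]⟩
  have hρX : ∀ i, ρ (X i) = C (u i) * X i := fun i => by rw [hρ, rescale_X']
  have hρX0 : ρ (X 0) = C b⁻¹ * X 0 := by rw [hρX, hu, if_pos rfl]
  have hρX1 : ρ (X 1) = X 1 := by
    rw [hρX, hu, if_neg (by simp), map_one, one_mul]
  have hρXj : ∀ j : Fin n, ρ (X (j.addNat 2)) = X (j.addNat 2) := fun j => by
    rw [hρX, hu, if_neg (by simp [Fin.ext_iff]), map_one, one_mul]
  have hρC : ∀ r : K, ρ (C r) = C r := fun r => by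
    rw [c_eq_algebraMap]; exact ρ.commutes r
  -- `h₁ := ρ h ∈ 𝔪³`
  obtain ⟨h₁, hh₁_def⟩ : ∃ h₁ : MvPowerSeries (Fin (n + 2)) K, h₁ = ρ h := ⟨_, rfl⟩
  have hh₁ : (3 : ℕ∞) ≤ h₁.order := by
    refine nat_le_order fun m hm => ?_
    rw [hh₁_def, hρ, coeff_rescale, coeff_of_lt_order (lt_of_lt_of_le (by exact_mod_cast hm) h3), mul_zero]
  -- §b the operators `[·]ₓ`, `[·]_y`, `[·]₀`, the coordinate family and the correction map
  obtain ⟨pX, hX⟩ : ∃ pX : MvPowerSeries (Fin (n + 2)) K → MvPowerSeries (Fin (n + 2)) K,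
      ∀ G m, coeff m (pX G) = coeff (m + Finsupp.single 0 1) G :=
    ⟨fun G m => coeff (m + Finsupp.single 0 1) G, fun _ _ => rfl⟩
  obtain ⟨pY, hY⟩ : ∃ pY : MvPowerSeries (Fin (n + 2)) K → MvPowerSeries (Fin (n + 2)) K,
      ∀ G m, coeff m (pY G) = if m 0 = 0 then coeff (m + Finsupp.single 1 1) G else 0 :=
    ⟨fun G m => if m 0 = 0 then coeff (m + Finsupp.single 1 1) G else 0, fun _ _ => rfl⟩
  obtain ⟨pZ, hZ⟩ : ∃ pZ : MvPowerSeries (Fin (n + 2)) K → MvPowerSeries (Fin (n + 2)) K,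
      ∀ G m, coeff m (pZ G) = if m 0 = 0 ∧ m 1 = 0 then coeff m G else 0 :=
    ⟨fun G m => if m 0 = 0 ∧ m 1 = 0 then coeff m G else 0, fun _ _ => rfl⟩
  obtain ⟨Sf, hSf⟩ : ∃ Sf : MvPowerSeries (Fin (n + 2)) K → MvPowerSeries (Fin (n + 2)) K →
      Fin (n + 2) → MvPowerSeries (Fin (n + 2)) K,
      ∀ α β i, Sf α β i = X i + (if i = 0 then β else if i = 1 then α else 0) := ⟨_, fun _ _ _ => rfl⟩
  obtain ⟨Nf, hNf⟩ : ∃ Nf : MvPowerSeries (Fin (n + 2)) K → MvPowerSeries (Fin (n + 2)) K →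
      MvPowerSeries (Fin (n + 2)) K,
      ∀ α β, Nf α β = α * β + C (a / b ^ 2) * β ^ 2 + C c * α ^ 2 + subst (Sf α β) h₁ := ⟨_, fun _ _ => rfl⟩
  obtain ⟨Θ, hΘ⟩ : ∃ Θ : MvPowerSeries (Fin (n + 2)) K × MvPowerSeries (Fin (n + 2)) K →
      MvPowerSeries (Fin (n + 2)) K × MvPowerSeries (Fin (n + 2)) K,
      ∀ p, Θ p = (pX (Nf p.1 p.2), pY (Nf p.1 p.2)) := ⟨_, fun _ => rfl⟩
  -- the two estimates for `Θ`: it preserves `𝔪² × 𝔪²` and gains one degree of agreement there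
  have hΘord : ∀ p : MvPowerSeries (Fin (n + 2)) K × MvPowerSeries (Fin (n + 2)) K,
      2 ≤ p.1.order → 2 ≤ p.2.order → 2 ≤ (Θ p).1.order ∧ 2 ≤ (Θ p).2.order := by
    intro p h1 h2
    have hN : ((2 + 1 : ℕ) : ℕ∞) ≤ (Nf p.1 p.2).order := by
      exact_mod_cast three_le_order_N Sf hSf (a / b ^ 2) c h₁ hh₁ Nf hNf h1 h2
    rw [hΘ]
    exact ⟨by exact_mod_cast le_order_pX pX hX hN, by exact_mod_cast le_order_pY pY hY hN⟩
  have hΘgain : ∀ (r : ℕ) (p q : MvPowerSeries (Fin (n + 2)) K × MvPowerSeries (Fin (n + 2)) K),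
      2 ≤ p.1.order → 2 ≤ p.2.order → 2 ≤ q.1.order → 2 ≤ q.2.order →
      AgreeUpTo r p.1 q.1 → AgreeUpTo r p.2 q.2 →
      AgreeUpTo (r + 1) (Θ p).1 (Θ q).1 ∧ AgreeUpTo (r + 1) (Θ p).2 (Θ q).2 := by
    intro r p q hp1 hp2 hq1 hq2 hpq1 hpq2
    have hN := agreeUpTo_N Sf hSf (a / b ^ 2) c h₁ hh₁ Nf hNf hp1 hp2 hq1 hq2 hpq1 hpq2
    rw [hΘ, hΘ]
    exact ⟨agreeUpTo_pX pX hX hN, agreeUpTo_pY pY hY hN⟩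
  -- §c the successive approximation `S₀ = (0,0)`, `S_{j+1} = Θ S_j` and its coefficientwise limit `(L₁, L₂)`
  obtain ⟨S, hS0, hS⟩ : ∃ S : ℕ → MvPowerSeries (Fin (n + 2)) K × MvPowerSeries (Fin (n + 2)) K,
      S 0 = (0, 0) ∧ ∀ j, S (j + 1) = Θ (S j) :=
    ⟨fun j => Nat.rec ((0 : MvPowerSeries (Fin (n + 2)) K), (0 : MvPowerSeries (Fin (n + 2)) K))
      (fun _ p => Θ p) j, rfl, fun _ => rfl⟩
  have hSord := iter_two_le_order Θ hΘord S hS0 hS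
  have hSst := iter_stable Θ hΘord hΘgain S hS0 hS
  obtain ⟨L₁, hL₁⟩ : ∃ L : MvPowerSeries (Fin (n + 2)) K, ∀ e, coeff e L = coeff e (S e.degree).1 :=
    ⟨fun e => coeff e (S e.degree).1, fun _ => rfl⟩
  obtain ⟨L₂, hL₂⟩ : ∃ L : MvPowerSeries (Fin (n + 2)) K, ∀ e, coeff e L = coeff e (S e.degree).2 :=
    ⟨fun e => coeff e (S e.degree).2, fun _ => rfl⟩
  have hlim₁ : ∀ j, AgreeUpTo j (S j).1 L₁ := fun j =>
    agreeUpTo_lim (T := fun j => (S j).1) (fun j => (hSst j).1) L₁ hL₁ j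
  have hlim₂ : ∀ j, AgreeUpTo j (S j).2 L₂ := fun j =>
    agreeUpTo_lim (T := fun j => (S j).2) (fun j => (hSst j).2) L₂ hL₂ j
  have hL₁ord : 2 ≤ L₁.order := by
    refine nat_le_order fun e he => ?_
    rw [← (hlim₁ e.degree) e le_rfl]
    exact coeff_of_lt_order (lt_of_lt_of_le (by exact_mod_cast he) (hSord _).1)
  have hL₂ord : 2 ≤ L₂.order := by
    refine nat_le_order fun e he => ?_
    rw [← (hlim₂ e.degree) e le_rfl]
    exact coeff_of_lt_order (lt_of_lt_of_le (by exact_mod_cast he) (hSord _).2)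
  -- the limit is a fixed point of `Θ`
  have hfix : Θ (L₁, L₂) = (L₁, L₂) := by
    have key : ∀ e : Fin (n + 2) →₀ ℕ,
        coeff e (Θ (L₁, L₂)).1 = coeff e L₁ ∧ coeff e (Θ (L₁, L₂)).2 = coeff e L₂ := by
      intro e
      have hg := hΘgain e.degree (S e.degree) (L₁, L₂) (hSord _).1 (hSord _).2 hL₁ord hL₂ord
        (hlim₁ _) (hlim₂ _)
      rw [← hS] at hg
      have h1 := (hSst e.degree).1 e (Nat.le_succ _)
      have h2 := (hSst e.degree).2 e (Nat.le_succ _)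
      have h3 := (hlim₁ e.degree) e le_rfl
      have h4 := (hlim₂ e.degree) e le_rfl
      exact ⟨by rw [← hg.1 e (Nat.le_succ _), ← h1, h3], by rw [← hg.2 e (Nat.le_succ _), ← h2, h4]⟩
    exact Prod.ext (MvPowerSeries.ext fun e => (key e).1) (MvPowerSeries.ext fun e => (key e).2)
  have hfix₁ : pX (Nf L₁ L₂) = L₁ := by
    have := congrArg Prod.fst hfix; rwa [hΘ] at this
  have hfix₂ : pY (Nf L₁ L₂) = L₂ := by
    have := congrArg Prod.snd hfix; rwa [hΘ] at this
  -- §d the coordinate change `x ↦ x + L₂`, `y ↦ y + L₁`, `z ↦ z` is an automorphism (formal inverse function theorem)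
  obtain ⟨e, he, heX⟩ := exists_algEquiv_eq_subst (monPlus_shift Sf hSf hL₁ord hL₂ord)
  have heX0 : e (X 0) = X 0 + L₂ := by rw [heX, hSf, if_pos rfl]
  have heX1 : e (X 1) = X 1 + L₁ := by rw [heX, hSf, if_neg (by simp), if_pos rfl]
  have heXj : ∀ j : Fin n, e (X (j.addNat 2)) = X (j.addNat 2) := fun j => by
    rw [heX, hSf, if_neg (by simp [Fin.ext_iff]), if_neg (by simp [Fin.ext_iff]), add_zero]
  have heC : ∀ r : K, e (C r) = C r := fun r => by
    rw [c_eq_algebraMap]; exact e.commutes r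
  -- §e assembly
  refine ⟨ρ.trans e, pZ (Nf L₁ L₂), fun j => ?_, fun m hm => ?_, ?_⟩
  · rw [AlgEquiv.trans_apply, hρXj, heXj]
  · rw [hZ] at hm
    split_ifs at hm with h0
    · refine ⟨?_, h0.1, h0.2⟩
      rw [hdeg]
      by_contra hlt
      exact hm (coeff_of_lt_order (lt_of_lt_of_le (by exact_mod_cast not_le.mp hlt)
        (three_le_order_N Sf hSf (a / b ^ 2) c h₁ hh₁ Nf hNf hL₁ord hL₂ord)))
    · exact absurd rfl hm
  · have h2 : (2 : MvPowerSeries (Fin (n + 2)) K) = 0 := by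
      rw [show (2 : MvPowerSeries (Fin (n + 2)) K) = C (2 : K) from (map_ofNat C 2).symm,
        CharTwo.two_eq_zero (R := K), map_zero]
    have hdec := decompose pX pY pZ hX hY hZ (Nf L₁ L₂)
    rw [hfix₁, hfix₂] at hdec
    have hNval := hNf L₁ L₂
    have hκ : C a * (C b⁻¹) ^ 2 = (C (a / b ^ 2) : MvPowerSeries (Fin (n + 2)) K) := by
      rw [← map_pow, ← map_mul]; congr 1; field_simp
    have hb1 : C b * C b⁻¹ = (1 : MvPowerSeries (Fin (n + 2)) K) := by
      rw [← map_mul, mul_inv_cancel₀ hb, map_one]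
    rw [AlgEquiv.trans_apply]
    simp only [map_add, map_mul, map_pow, map_sum, hρC, hρX0, hρX1, hρXj, heC, heX0, heX1, heXj]
    rw [← hh₁_def, he h₁]
    linear_combination (X 0 + L₂) ^ 2 * hκ + ((X 0 + L₂) * (X 1 + L₁)) * hb1 +
      (X 0 * L₁ + X 1 * L₂ + C (a / b ^ 2) * X 0 * L₂ + C c * X 1 * L₁) * h2 + hdec - hNval

end Literature.AlgebraicGeometry.Resolution

end
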